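import Summits.Ventures.DiscreteObjects.PP12.PrimeOrderStructure

/-!
# PP(12), family B1-p: the triangle case of a collineation of order 11 (FAMILY-B1P Lemma 4, Case B) — kernel
Framing: lottery ticket; floor = certified bounds/negative ranges.

Let `σ ≠ 1` be a collineation of a projective plane of order 12 with `σ¹¹ = 1` on points and NO axis (the homology
Case A excluded). Then (cell pub-namedobj, target M):
* every fixed line carries exactly two fixed points (`fixedOnLine_eq_two_of_no_axis`),
* every fixed point lies on exactly two fixed lines (`fixedThrough_eq_two_of_no_axis`, via the dual plane),
* there are exactly three fixed points and three fixed lines (`fixedCard_points_eq_three_of_no_axis`,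
  `fixedCard_lines_eq_three_of_no_axis`) — the fixed structure is a triangle.
This completes the kernel proof of the case split of FAMILY-B1P Lemma 4 (`p = 11`: homology or triangle); the
normal forms of the two cases (QDM array / triangle data, `OrderElevenCollineation.lean`) remain paper-derived.
-/

namespace Summit.Ventures.DiscreteObjects.PP12

open Configuration Finset

namespace Collineation

variable {P L : Type*} [Membership P L] [ProjectivePlane P L] [Fintype P] [Fintype L]
  [DecidableEq P] [DecidableEq L] (σ : Collineation P L)

/-- `Dual L` is a type synonym of `L`; transport decidable equality. -/
instance instDecidableEqDual : DecidableEq (Dual L) := ‹DecidableEq L›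

/-- number of fixed lines through the point `p` -/
def fixedThrough (p : P) [DecidablePred fun m : L => p ∈ m] : ℕ :=
  (univ.filter fun m : L => p ∈ m ∧ σ.onLines m = m).card

omit [ProjectivePlane P L] [Fintype P] [DecidableEq P] in
/-- `fixedThrough` is `fixedOnLine` of the dual collineation. -/
theorem fixedThrough_eq_dual (p : P) [DecidablePred fun m : L => p ∈ m] :
    σ.fixedThrough p = @fixedOnLine (Dual L) (Dual P) _ σ.dual _ _ (p : Dual P) ‹_› := by
  unfold fixedThrough fixedOnLine
  rfl

omit [DecidableEq P] [DecidableEq L] in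
/-- A centre yields an axis (dual of `exists_center_of_axis`). -/
theorem exists_axis_of_center {c : P} (hc : σ.IsCenter c) : ∃ l : L, σ.IsAxis l :=
  σ.dual.exists_center_of_axis (l := (c : Dual P)) hc

omit [DecidableEq P] [DecidableEq L] in
/-- If all lines are fixed then all points are fixed. -/
theorem onPoints_eq_one_of_onLines (h : σ.onLines = 1) : σ.onPoints = 1 := by
  ext p
  obtain ⟨a, b, -, ha, hb, -, hab, -, -⟩ :=
    exists_three_points (P := Dual L) (L := Dual P) (p : Dual P)
  -- a, b are lines through p
  have fa : σ.onLines a = a := by rw [h]; rfl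
  have fb : σ.onLines b = b := by rw [h]; rfl
  simpa using σ.point_fixed_of_two_fixed (m₁ := a) (m₂ := b) ha hb hab fa fb

section OrderTwelve

variable (h12 : ProjectivePlane.order P L = 12) (hne : σ.onPoints ≠ 1) (hq : σ.onPoints ^ 11 = 1)
  (hB : ∀ l : L, ¬ σ.IsAxis l)
include h12 hne hq hB

omit [DecidableEq L] in
/-- Case B, lines: with no axis, every fixed line carries exactly two fixed points. -/
theorem fixedOnLine_eq_two_of_no_axis {l : L} [DecidablePred (· ∈ l)] (hl : σ.onLines l = l) :
    σ.fixedOnLine l = 2 := by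
  rcases σ.order12_q11_axis_or_two h12 hne hq with ⟨l', c, hl', -, -⟩ | h
  · exact absurd hl' (hB l')
  · exact h l hl

omit [DecidableEq P] in
/-- Case B, points: with no axis, every fixed point lies on exactly two fixed lines (dual argument: a point on
13 fixed lines would be a centre, hence give an axis). -/
theorem fixedThrough_eq_two_of_no_axis {p : P} [DecidablePred fun m : L => p ∈ m] (hp : σ.onPoints p = p) :
    σ.fixedThrough p = 2 := by
  rw [fixedThrough_eq_dual]
  have h12' : ProjectivePlane.order (Dual L) (Dual P) = 12 := by rw [ProjectivePlane.Dual.order]; exact h12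
  have hneL : σ.dual.onPoints ≠ 1 := fun h => hne (σ.onPoints_eq_one_of_onLines h)
  have hqL : σ.dual.onPoints ^ 11 = 1 := σ.onLines_pow_eq_one hq
  have hBL : ∀ c : Dual P, ¬ σ.dual.IsAxis c := fun c hc => by
    obtain ⟨l, hl⟩ := σ.exists_axis_of_center hc
    exact hB l hl
  exact σ.dual.fixedOnLine_eq_two_of_no_axis h12' hneL hqL hBL hp

/-- Case B: exactly three fixed points. (Each fixed point `p` sees the other fixed points on distinct fixed lines
through `p`, of which there are two; and the count is `≡ 3 (mod 11)`.) -/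
theorem fixedCard_points_eq_three_of_no_axis : fixedCard σ.onPoints = 3 := by
  classical
  haveI : Fact (Nat.Prime 11) := ⟨by norm_num⟩
  have hmod := (σ.fixedCard_order12 h12).1 hq
  -- a fixed point
  have hpos : fixedCard σ.onPoints ≠ 0 := by omega
  set S : Finset P := univ.filter fun x => σ.onPoints x = x with hS
  have hSdef : fixedCard σ.onPoints = S.card := rfl
  obtain ⟨p, hpS⟩ := Finset.card_pos.mp (Nat.pos_of_ne_zero (hSdef ▸ hpos))
  have hp : σ.onPoints p = p := by simpa [hS] using hpS
  -- fixed lines through p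
  set T : Finset L := univ.filter fun m : L => p ∈ m ∧ σ.onLines m = m with hT
  have hTcard : T.card = 2 := σ.fixedThrough_eq_two_of_no_axis h12 hne hq hB hp
  obtain ⟨l₀, -⟩ := Nondegenerate.exists_line (L := L) p
  -- the map Q ↦ line pQ on S \ {p}
  let f : P → L := fun Q => if h : p = Q then l₀ else HasLines.mkLine h
  have hf_mem : ∀ Q ∈ S.erase p, p ∈ f Q ∧ Q ∈ f Q ∧ σ.onLines (f Q) = f Q := by
    intro Q hQ
    have hQp : Q ≠ p := (Finset.mem_erase.mp hQ).1
    have hQfix : σ.onPoints Q = Q := by simpa [hS] using (Finset.mem_erase.mp hQ).2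
    have hpQ : p ≠ Q := hQp.symm
    simp only [f, dif_neg hpQ]
    have hax := HasLines.mkLine_ax (L := L) hpQ
    exact ⟨hax.1, hax.2, σ.line_fixed_of_two_fixed hax.1 hax.2 hpQ hp hQfix⟩
  have hmaps : ∀ Q ∈ S.erase p, f Q ∈ T := fun Q hQ => by
    obtain ⟨h1, -, h3⟩ := hf_mem Q hQ
    simp [hT, h1, h3]
  have hinj : Set.InjOn f (S.erase p) := by
    intro Q hQ Q' hQ' hfeq
    by_contra hQQ'
    obtain ⟨hpQ, hQQ, fQ⟩ := hf_mem Q hQ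
    obtain ⟨-, hQ'Q', -⟩ := hf_mem Q' hQ'
    rw [← hfeq] at hQ'Q'
    have hQp : Q ≠ p := (Finset.mem_erase.mp hQ).1
    have hQ'p : Q' ≠ p := (Finset.mem_erase.mp hQ').1
    have hQfix : σ.onPoints Q = Q := by simpa [hS] using (Finset.mem_erase.mp hQ).2
    have hQ'fix : σ.onPoints Q' = Q' := by simpa [hS] using (Finset.mem_erase.mp hQ').2
    -- three distinct fixed points on the fixed line f Q, which carries exactly two
    have h2 : σ.fixedOnLine (f Q) = 2 := σ.fixedOnLine_eq_two_of_no_axis h12 hne hq hB fQ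
    unfold fixedOnLine at h2
    have hsub : ({p, Q, Q'} : Finset P) ⊆ univ.filter fun x => x ∈ f Q ∧ σ.onPoints x = x := by
      intro x hx
      simp only [Finset.mem_insert, Finset.mem_singleton] at hx
      rcases hx with rfl | rfl | rfl <;> simp [hpQ, hQQ, hQ'Q', hp, hQfix, hQ'fix]
    have h3 : ({p, Q, Q'} : Finset P).card = 3 := by
      rw [Finset.card_eq_three]; exact ⟨p, Q, Q', hQp.symm, hQ'p.symm, hQQ', rfl⟩
    have := Finset.card_le_card hsub
    omega
  have hle : (S.erase p).card ≤ T.card := Finset.card_le_card_of_injOn f hmaps hinj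
  rw [Finset.card_erase_of_mem hpS, hTcard] at hle
  omega

/-- Case B: exactly three fixed lines (the dual count). -/
theorem fixedCard_lines_eq_three_of_no_axis : fixedCard σ.onLines = 3 := by
  have h12' : ProjectivePlane.order (Dual L) (Dual P) = 12 := by rw [ProjectivePlane.Dual.order]; exact h12
  have hneL : σ.dual.onPoints ≠ 1 := fun h => hne (σ.onPoints_eq_one_of_onLines h)
  have hqL : σ.dual.onPoints ^ 11 = 1 := σ.onLines_pow_eq_one hq
  have hBL : ∀ c : Dual P, ¬ σ.dual.IsAxis c := fun c hc => by
    obtain ⟨l, hl⟩ := σ.exists_axis_of_center hc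
    exact hB l hl
  exact σ.dual.fixedCard_points_eq_three_of_no_axis h12' hneL hqL hBL

end OrderTwelve

end Collineation

end Summit.Ventures.DiscreteObjects.PP12
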